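import Mathlib
import HarnessLib
import Literature.AlgebraicGeometry.Resolution.AffineBlowup
import Literature.AlgebraicGeometry.Resolution.AffineBlowupCartier
import Literature.AlgebraicGeometry.Resolution.AffineBlowupUniversal
import Literature.AlgebraicGeometry.Resolution.BlowupsEquivariant
import Literature.AlgebraicGeometry.Resolution.BlowupPrincipalCharts

/-!
# The lifted action on `Bl_I(Spec R)` is `Proj` of the induced graded automorphism of the Rees algebra
(crux stmt-ResolutionOfSingularities-15640 `WildQuotients.WildQuotientResolution`, line `Sketch`;
chain w45c programmes V3U/V4U, res-L1-w45c-lead-1's ASK 2026-08-27T02:44:43Z «ToricExitProjMap»,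
CHAIN v7 §4 row stub-5 (plumbing); written by res-D-pv-033 AS res-L1-w45c-stub-5;
[OURS · L1 W4.5c] — generic scheme glue over Mathlib's `Proj.map`
(`Mathlib/AlgebraicGeometry/ProjectiveSpectrum/Functor.lean`), NOT a statement of any manuscript.)

For a ring endomorphism `τ : R → R` with `τ(I) ⊆ I`:

* `ToricExit.exists_reesGradedHom` — `τ` induces a graded endomorphism `φ` of the Rees algebra
  `R[It]` acting coefficientwise (`(φ x : R[t]) = (x : R[t]).map τ`); all later statements are
  parametrised by such a pair `(φ, hφ)` (no new definitions);
* `ToricExit.exists_mem_reesGrading_map_eq`, `ToricExit.irrelevant_le_map_reesGradedHom` — if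
  `τ` is surjective with `τ(I) = I` then `φ` is surjective degreewise and `R[It]₊ ≤ φ(R[It]₊)` (the
  hypothesis of `Proj.map`);
* `ToricExit.projMap_comp_π` — the square `Proj.map φ ≫ π = π ≫ Spec τ` for
  `π : Bl_I(Spec R) → Spec R`;
* `ToricExit.liftAction_hom_eq_projMap` — for a group `G` acting on `R` with the affine-quotient
  law `ρ g = Spec (g⁻¹ • ·)` and `I` stable, the lifted action on `Bl_I(Spec R)`
  (`IsBlowup.liftAction`, Literature `BlowupsEquivariant`) IS `Proj.map φ_{g⁻¹}`
  (`IsBlowup.liftAut_unique`);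
* COROLLARIES: `ToricExit.preimage_basicOpen_liftAction` (`(ρ♯ g)⁻¹ D₊(s) = D₊(φ_{g⁻¹} s)` for
  EVERY `s ∈ R[It]`, any degree) and `ToricExit.preimage_basicOpen_liftAction_of_invariant`
  (`= D₊(s)` when the coefficients of `s` are `G`-invariant — e.g. `T′t`, `H′³t²` of the twisted
  chart `W_T`, or `x_a t`, `x_a² t`); `ToricExit.awayι_comp_liftAction` (the chart square
  `Spec (R[It])_{(φ s)} → Spec (R[It])_{(s)}` over `ρ♯ g`, ring map `HomogeneousLocalization.Away.map φ s`,
  computed by `Away.map_mk`) — the equivariance input of the cone bricks.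
-/

-- single-problem summit: the doubled namespace component `ResolutionOfSingularities` is forced
set_option linter.dupNamespace false

noncomputable section

open CategoryTheory AlgebraicGeometry TopologicalSpace Polynomial HomogeneousLocalization
open Literature.AlgebraicGeometry.Resolution
open scoped Pointwise

namespace Summit.ResolutionOfSingularities.ResolutionOfSingularities.Theorems.WildQuotientResolution.ToricExit

universe u

variable {R : Type u} [CommRing R] {I : Ideal R}

/-! ## The graded endomorphism of the Rees algebra induced by `τ` -/

/-- **`τ : R → R` with `τ(I) ⊆ I` induces a graded endomorphism of the Rees algebra `R[It]`**,
acting coefficientwise. [folklore] -/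
theorem exists_reesGradedHom (τ : R →+* R) (hτ : I.map τ ≤ I) :
    ∃ φ : reesGrading I →+*ᵍ reesGrading I,
      ∀ x : reesAlgebra I, ((φ x : reesAlgebra I) : R[X]) = (x : R[X]).map τ := by
  have hmem : ∀ x : reesAlgebra I, (x : R[X]).map τ ∈ reesAlgebra I := by
    intro x
    rw [mem_reesAlgebra_iff]
    intro i
    rw [coeff_map]
    have hx : (x : R[X]).coeff i ∈ I ^ i := (mem_reesAlgebra_iff _ _).mp x.2 i
    have h1 : τ ((x : R[X]).coeff i) ∈ (I ^ i).map τ := Ideal.mem_map_of_mem _ hx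
    rw [Ideal.map_pow] at h1
    exact Ideal.pow_right_mono hτ i h1
  let φ₀ : reesAlgebra I →+* reesAlgebra I :=
    ((mapRingHom τ).comp (reesAlgebra I).val.toRingHom).codRestrict (reesAlgebra I)
      fun x => hmem x
  have hφ₀ : ∀ x : reesAlgebra I, ((φ₀ x : reesAlgebra I) : R[X]) = (x : R[X]).map τ :=
    fun x => rfl
  refine ⟨⟨φ₀, fun {i} {x} hx => ?_⟩, hφ₀⟩
  obtain ⟨r, hr⟩ := (mem_reesGrading_iff I).mp hx
  refine (mem_reesGrading_iff I).mpr ⟨τ r, ?_⟩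
  rw [hφ₀, ← hr, Polynomial.map_monomial]

variable (φ : reesGrading I →+*ᵍ reesGrading I) (τ : R →+* R)
  (hφ : ∀ x : reesAlgebra I, ((φ x : reesAlgebra I) : R[X]) = (x : R[X]).map τ)

include hφ in
/-- `φ` on the degree-one elements `b t`. [folklore] -/
theorem reesGradedHom_reesT (b : R) (hb : b ∈ I) (hb' : τ b ∈ I) :
    φ (reesT b hb) = reesT (τ b) hb' := by
  apply Subtype.ext
  rw [hφ, coe_reesT, coe_reesT, Polynomial.map_monomial]

include hφ in
/-- **Graded surjectivity**: if `τ` is surjective and `τ(I) = I` then every homogeneous element of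
`R[It]` is the image under `φ` of a homogeneous element of the same degree. [folklore] -/
theorem exists_mem_reesGrading_map_eq (hτs : Function.Surjective τ) (hτI : I.map τ = I)
    {i : ℕ} {x : reesAlgebra I} (hx : x ∈ reesGrading I i) :
    ∃ y : reesAlgebra I, y ∈ reesGrading I i ∧ φ y = x := by
  obtain ⟨r, hr⟩ := (mem_reesGrading_iff I).mp hx
  have hrI : r ∈ I ^ i := by
    have := (mem_reesAlgebra_iff _ _).mp x.2 i
    rwa [← hr, coeff_monomial, if_pos rfl] at this
  have hrI' : r ∈ (I ^ i).map τ := by rwa [Ideal.map_pow, hτI]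
  obtain ⟨r', hr'I, hr'⟩ := (Ideal.mem_map_iff_of_surjective τ hτs).mp hrI'
  refine ⟨⟨monomial i r', reesAlgebra.monomial_mem.mpr hr'I⟩, ⟨r', rfl⟩, Subtype.ext ?_⟩
  rw [hφ, ← hr]
  change (monomial i r').map τ = monomial i r
  rw [Polynomial.map_monomial, hr']

include hφ in
/-- **`R[It]₊ ≤ φ(R[It]₊)`** (the hypothesis of `Proj.map`) when `τ` is surjective with
`τ(I) = I`. [folklore] -/
theorem irrelevant_le_map_reesGradedHom (hτs : Function.Surjective τ) (hτI : I.map τ = I) :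
    HomogeneousIdeal.irrelevant (reesGrading I) ≤
      (HomogeneousIdeal.irrelevant (reesGrading I)).map φ := by
  rw [HomogeneousIdeal.irrelevant_le]
  intro i hi x hx
  obtain ⟨y, hy, rfl⟩ := exists_mem_reesGrading_map_eq φ τ hφ hτs hτI hx
  exact Ideal.mem_map_of_mem φ (HomogeneousIdeal.mem_irrelevant_of_mem _ hi hy)

/-! ## The square `Proj.map φ ≫ π = π ≫ Spec τ` -/

include hφ in
/-- `φ` on degree zero: `φ(r) = τ(r)`. [folklore] -/
theorem reesGradedHom_algebraMap (r : R) :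
    φ (algebraMap R (reesAlgebra I) r) = algebraMap R (reesAlgebra I) (τ r) := by
  apply Subtype.ext
  rw [hφ]
  simp

include hφ in
/-- The chart-level square on rings: for a homogeneous `s` of positive degree,
`(R[It])_{(s)} → (R[It])_{(φ s)}` (`Away.map φ s`) is compatible with `τ` on `R`. [folklore] -/
theorem awayMap_comp_fromZeroRingHom (s : reesAlgebra I) :
    (Away.map φ s).comp ((fromZeroRingHom (reesGrading I) (.powers s)).comp
        (reesGrading.zeroRingHom I)) =
      (fromZeroRingHom (reesGrading I) (.powers (φ s))).comp ((reesGrading.zeroRingHom I).comp τ) := by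
  refine RingHom.ext fun r => ?_
  apply HomogeneousLocalization.val_injective
  simp only [RingHom.comp_apply]
  change (Away.map φ s (HomogeneousLocalization.mk _)).val = (HomogeneousLocalization.mk _).val
  rw [Away.map, HomogeneousLocalization.map_mk, HomogeneousLocalization.val_mk,
    HomogeneousLocalization.val_mk]
  dsimp only
  congr 1
  · change (φ ((reesGrading.zeroRingHom I r : reesGrading I 0) : reesAlgebra I) : reesAlgebra I) =
      ((reesGrading.zeroRingHom I (τ r) : reesGrading I 0) : reesAlgebra I)
    rw [reesGrading.coe_zeroRingHom, reesGrading.coe_zeroRingHom, reesGradedHom_algebraMap φ τ hφ]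
  · exact Subtype.ext (map_one φ)

include hφ in
set_option backward.isDefEq.respectTransparency false in
/-- **The square `Proj.map φ ≫ π = π ≫ Spec τ`** for `π : Bl_I(Spec R) = Proj R[It] → Spec R`
(checked on the affine cover by the charts `Spec (R[It])_{(φ s)}`, `Proj.awayι_comp_map`,
`Proj.awayι_toSpecZero`). [folklore] -/
theorem projMap_comp_π
    (hf : HomogeneousIdeal.irrelevant (reesGrading I) ≤
      (HomogeneousIdeal.irrelevant (reesGrading I)).map φ) :
    Proj.map φ hf ≫ affineBlowup.π I = affineBlowup.π I ≫ Spec.map (CommRingCat.ofHom τ) := by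
  refine (Proj.mapAffineOpenCover φ hf).openCover.hom_ext _ _ fun s => ?_
  simp only [Scheme.AffineOpenCover.openCover_f, Proj.mapAffineOpenCover_f]
  rw [Proj.awayι_comp_map_assoc, affineBlowup.π]
  simp only [Category.assoc]
  rw [Proj.awayι_toSpecZero_assoc, Proj.awayι_toSpecZero_assoc, ← Spec.map_comp, ← Spec.map_comp,
    ← Spec.map_comp, ← Spec.map_comp]
  · congr 1
    change CommRingCat.ofHom ((Away.map φ _).comp ((fromZeroRingHom (reesGrading I) _).comp
      (reesGrading.zeroRingHom I))) =
      CommRingCat.ofHom ((fromZeroRingHom (reesGrading I) _).comp ((reesGrading.zeroRingHom I).comp τ))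
    rw [awayMap_comp_fromZeroRingHom φ τ hφ]
  · exact SetLike.coe_mem _

/-! ## The lifted action of a group is `Proj.map` -/

section Action

variable {G : Type*} [Group G] [MulSemiringAction G R]
  (ρ : G →* Aut (Spec (CommRingCat.of R)))
  (hρ : ∀ g : G, (ρ g).hom = Spec.map (CommRingCat.ofHom
    ((MulSemiringAction.toRingEquiv G R g⁻¹ : R ≃+* R) : R →+* R)))
  (hJ : ∀ g : G, (affineBlowup.idealSheaf I).comap (ρ g).hom = affineBlowup.idealSheaf I)

/-- **For a `G`-stable ideal, the graded endomorphism `φ_{g⁻¹}` of `R[It]` exists and satisfies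
the hypothesis of `Proj.map`.** (`hGI`: `g(I) = I` for all `g`, in `Ideal.map` form.) [folklore] -/
theorem exists_reesGradedHom_smul
    (hGI : ∀ g : G, I.map ((MulSemiringAction.toRingEquiv G R g : R ≃+* R) : R →+* R) = I)
    (g : G) :
    ∃ φ : reesGrading I →+*ᵍ reesGrading I,
      (∀ x : reesAlgebra I, ((φ x : reesAlgebra I) : R[X]) =
        (x : R[X]).map ((MulSemiringAction.toRingEquiv G R g⁻¹ : R ≃+* R) : R →+* R)) ∧
      HomogeneousIdeal.irrelevant (reesGrading I) ≤
        (HomogeneousIdeal.irrelevant (reesGrading I)).map φ := by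
  obtain ⟨φ, hφ⟩ := exists_reesGradedHom (I := I)
    ((MulSemiringAction.toRingEquiv G R g⁻¹ : R ≃+* R) : R →+* R) (hGI g⁻¹).le
  exact ⟨φ, hφ, irrelevant_le_map_reesGradedHom φ _ hφ
    (MulSemiringAction.toRingEquiv G R g⁻¹).surjective (hGI g⁻¹)⟩

variable (g : G) (φg : reesGrading I →+*ᵍ reesGrading I)
  (hφg : ∀ x : reesAlgebra I, ((φg x : reesAlgebra I) : R[X]) =
    (x : R[X]).map ((MulSemiringAction.toRingEquiv G R g⁻¹ : R ≃+* R) : R →+* R))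
  (hfg : HomogeneousIdeal.irrelevant (reesGrading I) ≤
    (HomogeneousIdeal.irrelevant (reesGrading I)).map φg)

include hρ hφg in
/-- **The lifted action IS `Proj.map`**: for the affine-quotient law `ρ g = Spec (g⁻¹ • ·)` and a
`G`-stable ideal sheaf, the lift of `ρ g` to `Bl_I(Spec R) = Proj R[It]`
(`IsBlowup.liftAction`, Görtz–Wedhorn I Prop. 13.91 (1)) is `Proj.map φ_{g⁻¹}`
(uniqueness of the lift, `IsBlowup.liftAut_unique`, and `projMap_comp_π`). [folklore] -/
theorem liftAction_hom_eq_projMap :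
    ((affineBlowup.isBlowup I).liftAction ρ hJ g).hom = Proj.map φg hfg := by
  rw [IsBlowup.liftAction_apply]
  symm
  refine (affineBlowup.isBlowup I).liftAut_unique (ρ g) (hJ g) ?_
  rw [projMap_comp_π φg _ hφg hfg, hρ g]

include hρ hφg hfg in
/-- **COROLLARY A: `(ρ♯ g)⁻¹ D₊(s) = D₊(φ_{g⁻¹} s)` for every `s ∈ R[It]`** (any degree;
`Proj.map_preimage_basicOpen`). [folklore] -/
theorem preimage_basicOpen_liftAction (s : reesAlgebra I) :
    ((affineBlowup.isBlowup I).liftAction ρ hJ g).hom ⁻¹ᵁ Proj.basicOpen (reesGrading I) s =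
      Proj.basicOpen (reesGrading I) (φg s) := by
  rw [liftAction_hom_eq_projMap ρ hρ hJ g φg hφg hfg, Proj.map_preimage_basicOpen]

include hρ in
/-- **COROLLARY A′: basic opens of `G`-INVARIANT elements of the Rees algebra are stable under the
lifted action** — `(ρ♯ g)⁻¹ D₊(s) = D₊(s)` whenever the coefficients of `s` are fixed by `g⁻¹`
(e.g. `s = x_a t`, `x_a² t`, `T′ t`, `H′³ t²` for the `J₃`/`J₄` data). [folklore] -/
theorem preimage_basicOpen_liftAction_of_invariant
    (hGI : ∀ g : G, I.map ((MulSemiringAction.toRingEquiv G R g : R ≃+* R) : R →+* R) = I)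
    (s : reesAlgebra I)
    (hs : (s : R[X]).map ((MulSemiringAction.toRingEquiv G R g⁻¹ : R ≃+* R) : R →+* R) = s) :
    ((affineBlowup.isBlowup I).liftAction ρ hJ g).hom ⁻¹ᵁ Proj.basicOpen (reesGrading I) s =
      Proj.basicOpen (reesGrading I) s := by
  obtain ⟨φ, hφ, hf⟩ := exists_reesGradedHom_smul (I := I) hGI g
  have hφs : φ s = s := Subtype.ext (by rw [hφ, hs])
  rw [preimage_basicOpen_liftAction ρ hρ hJ g φ hφ hf, hφs]

include hρ hφg hfg in
/-- **COROLLARY B (charts): the square `Spec (R[It])_{(φ s)} → Spec (R[It])_{(s)}` over `ρ♯ g`**,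
with ring map `HomogeneousLocalization.Away.map φ s` (computed on fractions by `Away.map_mk`:
numerator and denominator are mapped coefficientwise by `g⁻¹`). [folklore] -/
theorem awayι_comp_liftAction (s : reesAlgebra I) {i : ℕ} (hi : 0 < i)
    (hs : s ∈ reesGrading I i) :
    Proj.awayι (reesGrading I) (φg s) (φg.2 hs) hi ≫
        ((affineBlowup.isBlowup I).liftAction ρ hJ g).hom =
      Spec.map (CommRingCat.ofHom (Away.map φg s)) ≫ Proj.awayι (reesGrading I) s hs hi := by
  rw [liftAction_hom_eq_projMap ρ hρ hJ g φg hφg hfg, Proj.awayι_comp_map]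

include hρ hφg hfg in
/-- **COROLLARY B′ (sections): on the sections over `D₊(s)` the lifted action is
`HomogeneousLocalization.map φ_{g⁻¹}`** — for `s' = φ_{g⁻¹} s` (so `s' = s` for invariant `s`,
where this is an ENDOMORPHISM of `(R[It])_{(s)}`): the pull-back `Γ(Bl, D₊(s)) → Γ(Bl, D₊(s'))`
along `ρ♯ g` corresponds, under Mathlib's `Proj.awayToSection`, to `map φ : (R[It])_{(s)} → (R[It])_{(s')}`,
`x tⁿ/sᵐ ↦ (g⁻¹x) tⁿ/(g⁻¹s)ᵐ`. [folklore] -/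
theorem awayToSection_comp_appLE_liftAction (s s' : reesAlgebra I) (e : φg s = s') {i : ℕ}
    (hs : s ∈ reesGrading I i)
    (hP : Submonoid.powers s ≤ (Submonoid.powers s').comap φg)
    (hle : Proj.basicOpen (reesGrading I) s' ≤
      ((affineBlowup.isBlowup I).liftAction ρ hJ g).hom ⁻¹ᵁ Proj.basicOpen (reesGrading I) s) :
    Proj.awayToSection (reesGrading I) s ≫
        ((affineBlowup.isBlowup I).liftAction ρ hJ g).hom.appLE (Proj.basicOpen (reesGrading I) s)
          (Proj.basicOpen (reesGrading I) s') hle =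
      CommRingCat.ofHom (HomogeneousLocalization.map φg hP) ≫
        Proj.awayToSection (reesGrading I) s' := by
  subst e
  rw [appLE_congr_hom (liftAction_hom_eq_projMap ρ hρ hJ g φg hφg hfg)]
  exact Proj.awayToSection_comp_appLE φg hfg hs

/-! ## Convenience forms for pointwise-stable ideals and monomial elements -/

/-- Pointwise stability `g • I = I` in `Ideal.map` form. [folklore] -/
theorem map_toRingEquiv_eq_of_smul_eq (hGI' : ∀ g : G, g • I = I) (g : G) :
    I.map ((MulSemiringAction.toRingEquiv G R g : R ≃+* R) : R →+* R) = I := by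
  conv_rhs => rw [← hGI' g, Ideal.pointwise_smul_def]
  congr 1

include hρ in
/-- **`(ρ♯ g)⁻¹ D₊(r tⁿ) = D₊(r tⁿ)` for a `G`-invariant `r ∈ Iⁿ`** (pointwise-stable `I`).
[folklore] -/
theorem preimage_basicOpen_liftAction_of_monomial (hGI' : ∀ g : G, g • I = I)
    (s : reesAlgebra I) {n : ℕ} {r : R} (hsr : (s : R[X]) = monomial n r)
    (hr : ∀ g : G, g • r = r) :
    ((affineBlowup.isBlowup I).liftAction ρ hJ g).hom ⁻¹ᵁ Proj.basicOpen (reesGrading I) s =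
      Proj.basicOpen (reesGrading I) s := by
  refine preimage_basicOpen_liftAction_of_invariant ρ hρ hJ g
    (fun g => map_toRingEquiv_eq_of_smul_eq hGI' g) s ?_
  rw [hsr, Polynomial.map_monomial]
  congr 1
  change (MulSemiringAction.toRingEquiv G R g⁻¹) r = r
  rw [MulSemiringAction.toRingEquiv_apply_apply, hr]

include hρ in
/-- **The Rees chart `D₊(bt)` of a `G`-invariant `b ∈ I` is stable under the lifted action.**
[folklore] -/
theorem preimage_basicOpen_reesT_liftAction (hGI' : ∀ g : G, g • I = I) (b : R) (hb : b ∈ I)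
    (hbinv : ∀ g : G, g • b = b) :
    ((affineBlowup.isBlowup I).liftAction ρ hJ g).hom ⁻¹ᵁ
        Proj.basicOpen (reesGrading I) (reesT b hb) =
      Proj.basicOpen (reesGrading I) (reesT b hb) :=
  preimage_basicOpen_liftAction_of_monomial ρ hρ hJ g hGI' (reesT b hb) (coe_reesT b hb) hbinv

end Action

end Summit.ResolutionOfSingularities.ResolutionOfSingularities.Theorems.WildQuotientResolution.ToricExit

end
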